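import Mathlib
import HarnessLib
import HarnessLib.Audit
import Summits.CriticalPhenomena.Statement
import Literature.Probability.Percolation.CardyFormula
import Literature.Probability.Percolation.QuadCrossingRotationInvariance
import HarnessLib.Audit.Status.Attr

/-!
Route: CardyBlackNoise

# Route CardyBlackNoise — black noises have no Cameron–Martin directions — a positive-probability
overlay of bent and straight Z2 percolation gives Cardy

It suffices to show X = NonSingularOverlay ∧ OverlayUpgrade (card black-noise-no-cameron-martin, K1
+ M1–M3). NonSingularOverlay (K1,
lattice level, no scaling-limit object needed): for ONE conformal non-Möbius bending φ_ε(z) = z +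
εz³ of the unit disc 𝔻 there is
c > 0 such that for every finite family of quads Q₁…Q_n with closures in φ_ε(𝔻) and every set A of
crossing patterns, eventually as
δ → 0⁺, P_½[pattern of (Q_i) crossed by δℤ² ∈ A] ≤ P_½[pattern of (Q_i) crossed by φ_ε(δℤ² ∩ 𝔻̄) ∈
A] + (1 − c) — total variation
between the joint crossing laws of straight and bent percolation stays ≤ 1 − c, i.e. the two can be
overlaid with probability ≥ c at
all scales. OverlayUpgrade (the measure-class chain, typed as an implication): NonSingularOverlay →
BlackDichotomy →
SubseqConformalInvariance, where BlackDichotomy (M1/M2, abstract, provable now) says two probability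
laws making the same refining
families of sub-σ-algebras independent and both BLACK (Σ_cells Var E[X|F_cell] → 0) are equal or
mutually singular, and
SubseqConformalInvariance says every mesh sequence has a subsequence along which ALL bond-ℤ²
crossing probabilities converge to a
function of the cross-ratio. With the shared identification crux SubseqCardyRigidity (LSW locality ⇒
κ = 6 ⇒ f = F along the
subsequence) the conjunct follows and LimitExists is OUTPUT, never assumed.
Lean: `NonSingularOverlay ∧ OverlayUpgrade`

## Assembly
Pure logic plus the sequential characterisation of limits (PROVED sorry-free in the planner's
Sketch.lean, theorem assembly_holds):
OverlayUpgrade applied to NonSingularOverlay and BlackDichotomy gives SubseqConformalInvariance; fix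
R and a uniformizing datum with
cross-ratio η ∈ (0,1) (ConformalRectangle.crossRatio_mem_Ioo_of_isUniformizing); 𝓝[>] 0 is countably
generated, so by
Filter.tendsto_iff_seq_tendsto and Filter.tendsto_of_subseq_tendsto it suffices that every mesh
sequence has a subsequence along
which bondDomainCrossingProb R → F(η): SubseqConformalInvariance supplies the subsequence and f,
SubseqCardyRigidity gives f = F on
(0,1). ConformalGeneration rides in the chain as the typed engine of OverlayUpgrade's symmetry step
(logically idle in the glue).

Rationale: WHY THIS LINE. Mechanism (card black-noise-no-cameron-martin): every subsequential Schramm–Smirnov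
limit Ξ of bond-ℤ² percolation is a BLACK noise
over piecewise-smooth regions (SchrammSmirnov2011 Thm 1.7, Cor 1.8, via Tsirelson2003 §6.1 /
Tsirelson2014), and for black
factorising laws absolute continuity upgrades to equality: the density of an a.c. factorising law is
a multiplicative decomposable
functional, its first-chaos shadow vanishes, and the Hellinger identity Var_P √D = 1 − ∏_cells
(E√D_cell)² ≤ Σ_cells Var(√D_cell) → 0
forces D ≡ 1; a Lebesgue-decomposition/0-1 step gives the dichotomy "equal or mutually singular"
(BlackDichotomy, planner proof
sketch in § Numbers). Hence a Cardy counterexample is conformally HYPERSENSITIVE — φ_*Ξ_𝔻 ⊥ Ξ_(φ𝔻)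
for every non-Möbius conformal
φ — and, contrapositively, ANY positive-probability all-scale overlay of bent and straight
percolation for ONE bending (NonSingularOverlay)
plus exact translations, DKKMO rotations (DKKMO2020Rotational, Tassion2024) and a Lie generation
lemma (ConformalGeneration) gives
conformal invariance of every subsequential limit, and SubseqCardyRigidity (Schramm2000,
LawlerSchrammWerner2001, CamiaNewman2007)
pins the values. Imported areas: Tsirelson–Vershik theory of noises / continuous products
(measure-class rigidity of black noises),
Lie's classification of vector-field algebras on the line (pseudogroup generation), Le Cam-type
total-variation bookkeeping; no
observable, no discrete holomorphicity, no patchwork coupling (SeamPivotalNoGo explains why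
patchwork realises the singular side).
What it does that prior routes do not: CardyUniqueLimit / CardyRotToConf / CardyScaleErgodic attack
EQUALITY of laws or symmetry
DATA of correlations; here the load-bearing statement is a MEASURE-CLASS relation (TV < 1 on finite
crossing marginals), tolerant of
failure with any probability < 1 and with no union bound over scales, and blackness — already proved
for ℤ² in print — does the upgrade.

RANKED CRUXES. #0 SubseqConformalInvariance (target) — every sequence of meshes δ_k → 0⁺ has a
subsequence δ_(ψ k) and a function f with bondDomainCrossingProb R (δ_(ψ k)) → f(η(R)) for EVERY
conformal rectangle R and every uniformizing datum (existence along subsequences + conformal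
invariance, value unspecified; RSW compactness gives subsequences for countably many R, the content
is "all R, through the cross-ratio"). (why it might fail: It is the Aizenman/LPSA
conformal-invariance hypothesis for bond-ℤ² along subsequences — open (Schramm2007ICM Problem 2.11);
fails if some subsequential regime is only similarity-invariant, and no embedding-blind proof exists
(EmbeddingModulusUniqueness).) [Schramm2007ICM, Beffara2008Universal, arXiv:math/9401222,
SchrammSmirnov2011]
#2 NonSingularOverlay (crux) — (card K1, typed without the SS metric) there are ε ∈ (0, 1/12) and c
> 0 such that for every finite family of quads Q : Fin n → ConformalRectangle with closure (Q i) ⊆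
φ_ε(𝔻), φ_ε(z) = z + εz³, and every A ⊆ Set (Fin n), eventually as δ → 0⁺: P_½[{i | δℤ² crosses Q i}
∈ A] ≤ P_½[{i | φ_ε(δℤ² ∩ 𝔻̄) crosses Q i} ∈ A] + (1 − c); crossings are Schramm–Smirnov
continuum-arc events (`quadCrossing`; bent event = a path inside closure (Q i) ∩ φ_ε(𝔻̄ ∩
openEdgeUnion δ ω) joining arc 0 to arc 2). Equivalently TV(joint crossing laws) ≤ 1 − c uniformly
in the family: bent and straight percolation overlay with probability ≥ c at all scales.
[difficulty: open-problem] (why it might fail: Given OverlayUpgrade it is EQUIVALENT to conformal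
invariance of the ℤ² limit (card P1) — as hard as the conjunct; every coupling built so far
(patchwork, block RG) realises the singular side (SeamPivotalNoGo), and c > 0 may already need
control of all near-pivotal scales.) [SchrammSmirnov2011, DKKMO2020Rotational,
GarbanPeteSchramm2013Pivotal, arXiv:1305.5526, Beffara2008Universal]
#3 BlackDichotomy (crux) — (card K2/M1–M2, abstract engine) let P, Q be probability measures on (Ω,
m) and (F n i)_(i < N n), n ∈ ℕ, finite families of sub-σ-algebras of m, each family independent
under P AND under Q and generating m up to P- and Q-null sets; if P and Q are both BLACK along (F n)
— for every X ∈ L², Σ_i Var(E[X | F n i]) → 0 as n → ∞ (Tsirelson2003 Thm 88 form of "trivial first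
chaos") — then Q = P or Q ⟂ P. Two black factorising laws on one base are equal or mutually
singular: black noises have no Cameron–Martin / Girsanov directions. [deps: BlackNoCameronMartin]
[difficulty: M] (why it might fail: Planner sketch proves it (product Lebesgue decomposition G = ∩_i
S_iᶜ; Var√D = 1 − ∏m_i² ≤ Σ(1 − m_i²) → 0; 0-1 step via Q-blackness of 1_G); residual risk is
measure-theoretic: a.e.-generation bookkeeping, N n = 0, densities vs sub-σ-algebra restrictions in
Mathlib.) [Tsirelson2003, Tsirelson2014, TsirelsonVershik1998, doi:10.2307/1969123, arXiv:1305.5526]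
#4 OverlayUpgrade (crux) — (card M3 chain, typed as an implication between the route's statements)
NonSingularOverlay → BlackDichotomy → SubseqConformalInvariance. Intended proof, on the
Schramm–Smirnov quad-crossing space H (definition request D1): along any mesh sequence pass to a
joint subsequential limit (SS11 Cor 1.5–1.6); NonSingularOverlay + SS11 Lemma 5.1 (∂ of every
fixed-quad crossing event is null) + Thm 1.4(2) (crossings generate the Borel σ-field) give
TV(Ξ_(φ𝔻), φ_*Ξ_𝔻) ≤ 1 − c < 1; BlackDichotomy with cells = φ_ε-images of dyadic squares
(independence + a.e.-generation = SS11 Thm 1.7 for both laws; blackness = SS11 Cor 1.8 +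
Tsirelson2014 in Σ-Var form) gives φ_*Ξ_𝔻 = Ξ_(φ𝔻); Sym(Ξ) is a closed pseudogroup containing
lattice translations (exact) and rotations (DKKMO2020Rotational Thm 1.2 / Cor 1.3) and the
non-Möbius germ φ_ε, so by ConformalGeneration + Loewner isotopy it is all conformal germs;
conformal covariance of Ξ on quads plus boundary continuity (SS11 Lemma 5.1, three-arm) gives
convergence of bondDomainCrossingProb R along the subsequence to f_Ξ(η(R)) for every R. [deps:
NonSingularOverlay, BlackDichotomy, ConformalGeneration] [difficulty: XL] (why it might fail: Rests
on the SS space (D1) and printed-but-unformalised facts (SS11 Thm 1.7/Cor 1.8, blackness in Σ-Var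
form along CURVILINEAR dyadic grids via Tsirelson2014, DKKMO); the algebra→pseudogroup passage
(flows exhaust univalent maps) and wild-Jordan boundary continuity are unassembled.)
[SchrammSmirnov2011, Tsirelson2014, DKKMO2020Rotational, Tassion2024, CamiaNewman2006,
GarbanPeteSchramm2013Pivotal]
#5 SubseqCardyRigidity (crux) — (shared identification step, subsequence form of
CardyUniqueLimit.CardyRigidity) for every mesh sequence δ_k → 0⁺ and every f : ℝ → ℝ, if
bondDomainCrossingProb R (δ k) → f(η(R)) for every conformal rectangle R and uniformizing datum,
then f = cardyFunction on (0,1). Intended proof: with f as hitting kernel along the subsequence,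
exploration tightness (Aizenman–Burchard, RSW rsw_half) + conformal invariance + domain Markov ⇒
SLE_κ (Schramm2000), locality ⇒ κ = 6 (LawlerSchrammWerner2001) ⇒ f = F; explicit uniformizing data
from the Cayley map realise every η. [difficulty: L] (why it might fail: False only if some
subsequential regime is conformally invariant with f ≠ F; as a THEOREM it is CamiaNewman2007 Thm 2–3
run with unknown kernel f along a fixed mesh sequence: needs kernels in admissible non-Jordan
domains, moving marks, ℤ² a-priori arm bounds.) [CamiaNewman2007, Smirnov2001, Schramm2000,
LawlerSchrammWerner2001, KemppainenSmirnov2017, Werner2007]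
#9 BlackNoCameronMartin (support) — (card M1, the absolutely continuous half of BlackDichotomy;
prove first) if P is black along independent generating families (F n i) (a.e.-generation w.r.t. P),
Q makes the same families independent and Q ≪ P, then Q = P. Proof sketch: D = dQ/dP = ∏_i D_i^(n)
P-a.s. for each n (π-λ on ∩A_i); Y = √D has E[Y | F n i] = Y_i · EY / m_i with m_i = E Y_i ∈ (0,1],
so blackness gives Σ_i (1 − m_i²) → 0, while Var Y = 1 − ∏_i m_i² ≤ Σ_i (1 − m_i²); hence Y is
constant, D ≡ 1. [difficulty: provable-now] [Tsirelson2003, TsirelsonVershik1998,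
doi:10.2307/1969123]
#9 ConformalGeneration (support) — (card K3, Lie-algebra level) let L be a set of functions
holomorphic on the unit disc (membership decided on the disc), an ℝ-linear subspace closed under the
bracket [f,g] = f g′ − f′ g, under rotations f ↦ (w ↦ e^(iθ) f(e^(−iθ) w)) and under locally uniform
limits on the disc, containing 1, i and i·z (the Euclidean algebra e(2)); then EITHER every element
of L is a polynomial of degree ≤ 2 on the disc (L ⊆ Möbius algebra) OR L contains every function
holomorphic on the disc. Proof sketch: Fourier-isolate a mode a_k z^k with k ≥ 3 by averaging
rotations against cos/sin((k−1)θ) (Riemann sums + closure), get ℂ z^k ⊆ L; [1, z^k] = k z^(k−1)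
descends, [z², z^k] = (k−2) z^(k+1) ascends; Taylor partial sums are locally uniformly dense.
[difficulty: provable-now] [doi:10.1007/978-1-4612-4350-2, arXiv:2012.11672, arXiv:1101.5820]

TWO-LAYER PLAN. Foreseen glued splits (filed only after a crux closes / D1 lands, k ≤ 3, depth 1):
OverlayUpgrade ⇐ MeasureClassUpgrade →
SymmetryToInvariance → OverlayUpgrade, where MeasureClassUpgrade = "NonSingularOverlay ⇒ (φ_ε)_*Ξ_𝔻
= Ξ_(φ_ε𝔻) for every
subsequential SS limit Ξ" (BlackDichotomy instance on H_(φ_ε𝔻); needs D1 + facts SS11 Thm 1.7 / Cor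
1.8 / Lemma 5.1, Tsirelson2014)
and SymmetryToInvariance = "equality for φ_ε on 𝔻 + DKKMO rotations + lattice translations ⇒ g_*Ξ_U
= Ξ_(gU) for all conformal g ⇒
SubseqConformalInvariance" (closed pseudogroup, ConformalGeneration, Loewner isotopy, boundary
continuity). BlackDichotomy ⇐
BlackNoCameronMartin → DefectZeroOne → BlackDichotomy (DefectZeroOne: the non-singular set G = ∩_i
S_iᶜ has Q(G) ∈ {0,1} by
Q-blackness of 1_G). SubseqCardyRigidity ⇐ SubseqExplorationSLE → LocalityKappaSix →
SubseqCardyRigidity, as for CardyUniqueLimit r2.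

KILL CRITERIA. ¬NonSingularOverlay proved at lattice level (a zero-overlap theorem for the cubic
bending: TV → 1 on growing finite families) closes
the route `refuted:NonSingularOverlay` — and, given OverlayUpgrade's printed facts, is itself
evidence against conformal invariance of
the ℤ² limit, to be handed to the negative side. ¬BlackDichotomy by an abstract counterexample
forces a RESTATE with noise-type
completeness / continuity hypotheses (Tsirelson2014 §1.5), not a close. ¬OverlayUpgrade (=
NonSingularOverlay ∧
¬SubseqConformalInvariance) kills the mechanism outright: close refuted. ¬SubseqCardyRigidity
refutes the conjunct itself (a
conformally invariant non-Cardy regime). NegDegenerateArcs (CardyUniqueLimit r6) proved ⇒ conjunct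
false as typed ⇒ blocked with
every sibling. CardyFormulaZ2 or CardyUniqueLimitThesis proved elsewhere moots the route;
CardyRigidity (stmt-0746) proved
elsewhere makes SubseqCardyRigidity a corollary of the same proof.

NOT DECOMPOSED YET. The Schramm–Smirnov-space children of OverlayUpgrade (MeasureClassUpgrade,
SymmetryToInvariance) until D1 `QuadCrossingSpace` and
the cite facts land; the coupling / transport technology for NonSingularOverlay (DKKMO
track-exchange transports as integrable global
maps, co-adapted steering of the two explorations, factor-of-iid maps — the card's engineering bet,
deliberately left to provers); the
negative item ¬NonSingularOverlay (filed with a rank when a refuter wants it staffed); boundary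
regularity of crossing probabilities for
wild Jordan domains (shared with CardyUniqueLimit.NegDegenerateArcs); the interior of
SubseqCardyRigidity (hitting-kernel skeleton).

CHEAPEST FALSIFIER. (i) Lookup: is "two black factorising laws are equal or singular" / "no a.c.
factorising perturbation of a black noise" printed
(TsirelsonVershik1998, Tsirelson2003 §6, Tsirelson 'Nonclassical stochastic flows'
arXiv:math/0402431)? If yes, BlackDichotomy is
`known` (support) and the route's novelty is the CI application only — searched (§ Novelty), not
found. (ii) Sanity refutation of
BlackDichotomy as TYPED on degenerate data (N n = 0, two-point Ω, Q = point mass): planner checked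
by hand that a.e.-generation +
double independence make these cases true or vacuous — a refuter should re-run it in Lean. (iii) kit
numerics (not run: hub is
compute-free for planners here): TV between the joint crossing laws of k = 1…4 rectangles in φ_ε(𝔻),
ε = 0.05, under δℤ² and under
φ_ε(δℤ² ∩ 𝔻̄), δ = 1/32…1/256 — must DECREASE with δ if the conjunct holds (LPSA94 numerics match
Cardy to 5e-3); growth towards 1
would flag the singular side.

NUMBERS. ε < 1/12 makes φ_ε(z) = z + εz³ injective on 𝔻̄ (|φ_ε′ − 1| ≤ 3ε < 1/4) and non-Möbius
(Schwarzian ≠ 0). Overlay probability =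
1 − TV (maximal coupling). Beffara2008Universal Prop 4: 0 or 2 conformally invariant moduli per
graph. Half-plane 3-arm exponent 2
(boundary lattice-alignment effects O(δ)); polychromatic 5-arm exponent 2, pivotal exponent 5/4
(GarbanPeteSchramm2013Pivotal).
Planner proof sketch of BlackDichotomy: (a) per n, Lebesgue sets S_i ∈ F n i with P(S_i) = 0, Q(· ∩
∩_i S_iᶜ) = (∏_i D_i)·P on the
π-system ∩A_i hence on m (a.e.-generation), so G := ∩_i S_iᶜ is the P-non-singular set of Q for
every n and a := Q(G); (b) a = 0 ⇒
Q ⟂ P; (c) a > 0 ⇒ Q′ := Q(· | G) ≪ P factorises over every (F n i) (conditioning a product on a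
product event) and P-blackness gives
Q′ = P by BlackNoCameronMartin (Var√D = 1 − ∏m_i² ≤ Σ(1 − m_i²) → 0); (d) E_Q[1_G | F n i] =
1_(S_iᶜ) · a / a_i, so Q-blackness gives
Σ_i (1 − a_i) → 0 while ∏_i a_i = a, hence a = 1 and Q = P. Items at open: 8 (1 target, 4 cruxes, 2
support, 1 assembly).

DEFINITION REQUESTS. D1 `QuadCrossingSpace` (topic Literature/Probability/Percolation): the
Schramm–Smirnov space H_D of closed hereditary sets of quads in
a domain D with its compact metrisable topology (SS11 Thm 1.4), Borel σ-field = σ(crossing events),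
sub-σ-fields F_U (U ⊆ D open),
the measurable map BondConfig (Site 2) → H_D at mesh δ (via openEdgeUnion), push-forward by
homeomorphisms / conformal maps, and
"subsequential scaling limit of bond-ℤ² percolation at p = 1/2 in D"; wanted for OverlayUpgrade's
children. Cite facts wanted
(family crit-ising): SS11 Thm 1.7 (factorisation, a.e.), Cor 1.8 + Tsirelson2014 (blackness, Σ-Var
form along refining finite
subalgebras), Lemma 5.1 (∂ crossing events null); DKKMO Cor 1.3 is in tree
(`dkkmo_crossing_rotation_invariance`).

Novelty: Searches (2026-08-15): `lit search --source zbmath "black noise absolutely continuous measure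
factorization Tsirelson"` (0 rows);
`lit search --source all "Tsirelson noise equivalent measures quasi-invariance black noise"` (rc 75,
searchd unavailable);
`lit galaxy search "black noise" --star all` (42 rows, all off-topic fiction/web), `lit galaxy
search "Tsirelson black noise" --star pdf` (0);
`lit vsearch "<BlackDichotomy in prose>"` (12 book rows, none on noises); `lit read
arXiv:math/0301237 --grep 'absolutely continuous|…'`
(4 hits; §6.1 Thm 87–88 read: decomposable additive AND multiplicative processes generate F_stable,
first chaos = strong limit of Σ E[·|cell]);
`lit read arXiv:1111.7270 --grep 'absolutely continuous|equivalent|finite Boolean subalgebra'` (12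
hits: only spectral measure CLASSES,
Fact 34 / Example 82, and first chaos over finite subalgebras §7); `lit read arXiv:1101.5820` (Thm
1.4, Cor 1.5–1.6, Thm 1.7, Cor 1.8,
Lemma 5.1 read); `lit frontier CriticalPhenomena --since 2020` (30 rows, none on ℤ² conformal
invariance or noise rigidity); `lit bridges
CriticalPhenomena --cross any` (30 rows, none); grep of the 38 route files of the sub for black
noise / Tsirelson / mutually singular /
measure class (0 routes use noise rigidity; SeamPivotalNoGo, CardyRetileGlue use SS factorisation
only); the card's own zbMATH list
"Tsirelson black noise" (14 rows, all constructions of black noises). `lean search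
quadCrossing|iIndep|MutuallySingular` for the decls.
Nearest pr  [refs: math/0301237, 1111.7270, 1101.5820, 1301.5175, Tsirelson2003, TsirelsonVershik1998, SchrammSmirnov2011]

Barriers (technique_class: black-noise-rigidity, measure-class-dichotomy): - technique_class: black-noise-rigidity, measure-class-dichotomy
- Literature.Barriers.CriticalPhenomena.EmbeddingModulusUniqueness: evaded — the argument is not
shear-invariant: NonSingularOverlay compares δℤ² with its CONFORMAL bending and is false for a
sheared copy φ_β(ℤ²) (whose limit, if it exists, is singular to its conformal images: the shear is
detected a.s. scale by scale, Kakutani), and OverlayUpgrade imports the embedding-specific inputs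
the barrier names as evasion (i): exact lattice translations/π/2-symmetry and
`dkkmo_crossing_rotation_invariance` (DKKMO2020Rotational Cor 1.3); SubseqCardyRigidity carries the
symmetry inside its hypothesis, the exemption the barrier grants CardyRigidity.
- Literature.Barriers.CriticalPhenomena.SmirnovTriangularOnly: not in its class — no harmonic
triple, no ψ-sum, no colour switching; Smirnov/CN enter only through the identification crux
SubseqCardyRigidity, as in every route of the sub.
- Literature.Barriers.CriticalPhenomena.FKParafermionicHalfCauchyRiemann: not in its class (no
vertex observable, no boundary-value problem).
- Literature.Barriers.CriticalPhenomena.CoveringLatticeShift: not in its class (no mixed site/bond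
family, no Russo pairing, no interpolation in p or q).
- Literature.Barriers.CriticalPhenomena.ScaleCovarianceNotMoebius: catalogued for
Ising3DConformalLimit (symmetry-upgrade class); here a MEASURE-CLASS relation is upgraded by
blackness + factorisation, absent from that class, and the non-symmetry input i

sub-problem: CardyFormulaZ2 · status: draft · opened planner-plancard-CriticalPhenomena-CardyFormu-2e2640c8-0 2026-08-15T13:35:17Z · rev 1 · ledger route-CriticalPhenomena-CardyBlackNoise
GENERATED by the gate from the ledger (D-0016/17). Provers cite these decls: `theorem foo : Summit.CriticalPhenomena.CardyFormulaZ2.Theses.CardyBlackNoise.<Decl> := …` in Summits/CriticalPhenomena/CardyFormulaZ2/Theorems/<Name>.lean.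
-/

namespace Summit.CriticalPhenomena.CardyFormulaZ2.Theses.CardyBlackNoise

open scoped BigOperators Topology Manifold Classical MeasureTheory ProbabilityTheory Matrix InnerProductSpace ComplexConjugate ContinuousMap
open Filter Set Function TopologicalSpace MeasureTheory

attribute [summit_statement] _root_.CardyFormulaZ2

/-- item stmt-CriticalPhenomena-8846 · target · rank 0 · open · by planner
why it might fail: It is the Aizenman/LPSA conformal-invariance hypothesis for bond-ℤ² along subsequences — open (Schramm2007ICM Problem 2.11); fails if some subsequential regime is only similarity-invariant, and no embedding-blind proof exists (EmbeddingModulusUniqueness).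
sources: Schramm2007ICM, Beffara2008Universal, arXiv:math/9401222, SchrammSmirnov2011
[target] every sequence of meshes δ_k → 0⁺ has a subsequence δ_(ψ k) and a function f with
bondDomainCrossingProb R (δ_(ψ k)) → f(η(R)) for EVERY conformal rectangle R and every uniformizing
datum (existence along subsequences + conformal invariance, value unspecified; RSW compactness gives
subsequences for countably many R, the content is "all R, through the cross-ratio"). -/
@[route_item "route-CriticalPhenomena-CardyBlackNoise"]
def SubseqConformalInvariance : Prop :=
  ∀ δ : ℕ → ℝ, Filter.Tendsto δ Filter.atTop (nhdsWithin (0 : ℝ) (Set.Ioi 0)) → ∃ (ψ : ℕ → ℕ) (f : ℝ → ℝ), StrictMono ψ ∧ ∀ (R : Literature.Probability.RandomPlanarGeometry.ConformalRectangle) (φ : Literature.Probability.RandomPlanarGeometry.ConformalEquiv UpperHalfPlane.upperHalfPlaneSet R.carrier) (x : Fin 4 → ℝ), R.IsUniformizing φ x → Filter.Tendsto (fun k => Literature.Probability.Percolation.bondDomainCrossingProb R (δ (ψ k))) Filter.atTop (nhds (f (Literature.Probability.RandomPlanarGeometry.crossRatio x)))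

/-- item stmt-CriticalPhenomena-8847 · crux · rank 2 · open · by planner
why it might fail: Given OverlayUpgrade it is EQUIVALENT to conformal invariance of the ℤ² limit (card P1) — as hard as the conjunct; every coupling built so far (patchwork, block RG) realises the singular side (SeamPivotalNoGo), and c > 0 may already need control of all near-pivotal scales.
sources: SchrammSmirnov2011, DKKMO2020Rotational, GarbanPeteSchramm2013Pivotal, arXiv:1305.5526, Beffara2008Universal
[crux] (card K1, typed without the SS metric) there are ε ∈ (0, 1/12) and c > 0 such that for every
finite family of quads Q : Fin n → ConformalRectangle with closure (Q i) ⊆ φ_ε(𝔻), φ_ε(z) = z + εz³,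
and every A ⊆ Set (Fin n), eventually as δ → 0⁺: P_½[{i | δℤ² crosses Q i} ∈ A] ≤ P_½[{i | φ_ε(δℤ² ∩
𝔻̄) crosses Q i} ∈ A] + (1 − c); crossings are Schramm–Smirnov continuum-arc events (`quadCrossing`;
bent event = a path inside closure (Q i) ∩ φ_ε(𝔻̄ ∩ openEdgeUnion δ ω) joining arc 0 to arc 2).
Equivalently TV(joint crossing laws) ≤ 1 − c uniformly in the family: bent and straight percolation
overlay with probability ≥ c at all scales. [difficulty: open-problem] -/
@[route_item "route-CriticalPhenomena-CardyBlackNoise", crux]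
def NonSingularOverlay : Prop :=
  ∃ ε : ℝ, 0 < ε ∧ ε < 1 / 12 ∧ ∃ c : ℝ, 0 < c ∧ ∀ (n : ℕ) (Q : Fin n → Literature.Probability.RandomPlanarGeometry.ConformalRectangle), (∀ i, closure (Q i).carrier ⊆ (fun z : ℂ => z + (ε : ℂ) * z ^ 3) '' Metric.ball (0 : ℂ) 1) → ∀ A : Set (Set (Fin n)), ∀ᶠ δ in nhdsWithin (0 : ℝ) (Set.Ioi 0), (Literature.Probability.Percolation.bondPercolation (Literature.Probability.LatticeModels.zdGraph 2) Literature.Probability.Percolation.half).real {ω | {i | ω ∈ Literature.Probability.Percolation.quadCrossing (Q i) δ} ∈ A} ≤ (Literature.Probability.Percolation.bondPercolation (Literature.Probability.LatticeModels.zdGraph 2) Literature.Probability.Percolation.half).real {ω | {i | ∃ a ∈ (Q i).arc 0, ∃ b ∈ (Q i).arc 2, JoinedIn (closure (Q i).carrier ∩ (fun z : ℂ => z + (ε : ℂ) * z ^ 3) '' (Metric.closedBall (0 : ℂ) 1 ∩ Literature.Probability.Percolation.openEdgeUnion δ ω)) a b} ∈ A} + (1 - c)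

/-- item stmt-CriticalPhenomena-8848 · crux · rank 3 · open · by planner
why it might fail: Planner sketch proves it (product Lebesgue decomposition G = ∩_i S_iᶜ; Var√D = 1 − ∏m_i² ≤ Σ(1 − m_i²) → 0; 0-1 step via Q-blackness of 1_G); residual risk is measure-theoretic: a.e.-generation bookkeeping, N n = 0, densities vs sub-σ-algebra restrictions in Mathlib.
sources: Tsirelson2003, Tsirelson2014, TsirelsonVershik1998, doi:10.2307/1969123, arXiv:1305.5526
[crux] (card K2/M1–M2, abstract engine) let P, Q be probability measures on (Ω, m) and (F n i)_(i <
N n), n ∈ ℕ, finite families of sub-σ-algebras of m, each family independent under P AND under Q and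
generating m up to P- and Q-null sets; if P and Q are both BLACK along (F n) — for every X ∈ L², Σ_i
Var(E[X | F n i]) → 0 as n → ∞ (Tsirelson2003 Thm 88 form of "trivial first chaos") — then Q = P or
Q ⟂ P. Two black factorising laws on one base are equal or mutually singular: black noises have no
Cameron–Martin / Girsanov directions. [deps: BlackNoCameronMartin] [difficulty: M] -/
@[route_item "route-CriticalPhenomena-CardyBlackNoise", crux]
def BlackDichotomy : Prop :=
  ∀ (Ω : Type) (m : MeasurableSpace Ω) (P Q : MeasureTheory.Measure Ω) (N : ℕ → ℕ) (F : (n : ℕ) → Fin (N n) → MeasurableSpace Ω), MeasureTheory.IsProbabilityMeasure P → MeasureTheory.IsProbabilityMeasure Q → (∀ n i, F n i ≤ m) → (∀ n (s : Set Ω), MeasurableSet s → ∃ t : Set Ω, MeasurableSet[⨆ i, F n i] t ∧ Filter.EventuallyEq (MeasureTheory.ae P) s t ∧ Filter.EventuallyEq (MeasureTheory.ae Q) s t) → (∀ n, ProbabilityTheory.iIndep (F n) P) → (∀ n, ProbabilityTheory.iIndep (F n) Q) → (∀ X : Ω → ℝ, MeasureTheory.MemLp X 2 P → Filter.Tendsto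 (fun n => ∑ i : Fin (N n), ProbabilityTheory.variance (MeasureTheory.condExp (F n i) P X) P) Filter.atTop (nhds 0)) → (∀ X : Ω → ℝ, MeasureTheory.MemLp X 2 Q → Filter.Tendsto (fun n => ∑ i : Fin (N n), ProbabilityTheory.variance (MeasureTheory.condExp (F n i) Q X) Q) Filter.atTop (nhds 0)) → Q = P ∨ MeasureTheory.Measure.MutuallySingular Q P

/-- item stmt-CriticalPhenomena-8849 · crux · rank 4 · open · by planner
why it might fail: Rests on the SS space (D1) and printed-but-unformalised facts (SS11 Thm 1.7/Cor 1.8, blackness in Σ-Var form along CURVILINEAR dyadic grids via Tsirelson2014, DKKMO); the algebra→pseudogroup passage (flows exhaust univalent maps) and wild-Jordan boundary continuity are unassembled.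
sources: SchrammSmirnov2011, Tsirelson2014, DKKMO2020Rotational, Tassion2024, CamiaNewman2006, GarbanPeteSchramm2013Pivotal
[crux] (card M3 chain, typed as an implication between the route's statements) NonSingularOverlay →
BlackDichotomy → SubseqConformalInvariance. Intended proof, on the Schramm–Smirnov quad-crossing
space H (definition request D1): along any mesh sequence pass to a joint subsequential limit (SS11
Cor 1.5–1.6); NonSingularOverlay + SS11 Lemma 5.1 (∂ of every fixed-quad crossing event is null) +
Thm 1.4(2) (crossings generate the Borel σ-field) give TV(Ξ_(φ𝔻), φ_*Ξ_𝔻) ≤ 1 − c < 1;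
BlackDichotomy with cells = φ_ε-images of dyadic squares (independence + a.e.-generation = SS11 Thm
1.7 for both laws; blackness = SS11 Cor 1.8 + Tsirelson2014 in Σ-Var form) gives φ_*Ξ_𝔻 = Ξ_(φ𝔻);
Sym(Ξ) is a closed pseudogroup containing lattice translations (exact) and rotations
(DKKMO2020Rotational Thm 1.2 / Cor 1.3) and the non-Möbius germ φ_ε, so by ConformalGeneration +
Loewner isotopy it is all conformal germs; conformal covariance of Ξ on quads plus boundary
continuity (SS11 Lemma 5.1, three-arm) gives convergence of bondDomainCrossingProb R along the
subsequence to f_Ξ(η(R)) for every R. [deps: NonSingularOverlay, BlackDichotomy,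
ConformalGeneration] [difficulty: XL] -/
@[route_item "route-CriticalPhenomena-CardyBlackNoise", crux]
def OverlayUpgrade : Prop :=
  NonSingularOverlay → BlackDichotomy → SubseqConformalInvariance

/-- item stmt-CriticalPhenomena-8850 · crux · rank 5 · open · by planner
why it might fail: False only if some subsequential regime is conformally invariant with f ≠ F; as a THEOREM it is CamiaNewman2007 Thm 2–3 run with unknown kernel f along a fixed mesh sequence: needs kernels in admissible non-Jordan domains, moving marks, ℤ² a-priori arm bounds.
sources: CamiaNewman2007, Smirnov2001, Schramm2000, LawlerSchrammWerner2001, KemppainenSmirnov2017, Werner2007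
[crux] (shared identification step, subsequence form of CardyUniqueLimit.CardyRigidity) for every
mesh sequence δ_k → 0⁺ and every f : ℝ → ℝ, if bondDomainCrossingProb R (δ k) → f(η(R)) for every
conformal rectangle R and uniformizing datum, then f = cardyFunction on (0,1). Intended proof: with
f as hitting kernel along the subsequence, exploration tightness (Aizenman–Burchard, RSW rsw_half) +
conformal invariance + domain Markov ⇒ SLE_κ (Schramm2000), locality ⇒ κ = 6
(LawlerSchrammWerner2001) ⇒ f = F; explicit uniformizing data from the Cayley map realise every η.
[difficulty: L] -/
@[route_item "route-CriticalPhenomena-CardyBlackNoise", crux]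
def SubseqCardyRigidity : Prop :=
  ∀ (δ : ℕ → ℝ) (f : ℝ → ℝ), Filter.Tendsto δ Filter.atTop (nhdsWithin (0 : ℝ) (Set.Ioi 0)) → (∀ (R : Literature.Probability.RandomPlanarGeometry.ConformalRectangle) (φ : Literature.Probability.RandomPlanarGeometry.ConformalEquiv UpperHalfPlane.upperHalfPlaneSet R.carrier) (x : Fin 4 → ℝ), R.IsUniformizing φ x → Filter.Tendsto (fun k => Literature.Probability.Percolation.bondDomainCrossingProb R (δ k)) Filter.atTop (nhds (f (Literature.Probability.RandomPlanarGeometry.crossRatio x)))) → Set.EqOn f Literature.Probability.RandomPlanarGeometry.cardyFunction (Set.Ioo 0 1)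

/-- item stmt-CriticalPhenomena-8851 · support · rank 9 · open · by planner
sources: Tsirelson2003, TsirelsonVershik1998, doi:10.2307/1969123
[support] (card M1, the absolutely continuous half of BlackDichotomy; prove first) if P is black
along independent generating families (F n i) (a.e.-generation w.r.t. P), Q makes the same families
independent and Q ≪ P, then Q = P. Proof sketch: D = dQ/dP = ∏_i D_i^(n) P-a.s. for each n (π-λ on
∩A_i); Y = √D has E[Y | F n i] = Y_i · EY / m_i with m_i = E Y_i ∈ (0,1], so blackness gives Σ_i (1
− m_i²) → 0, while Var Y = 1 − ∏_i m_i² ≤ Σ_i (1 − m_i²); hence Y is constant, D ≡ 1. [difficulty: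
provable-now] -/
@[route_item "route-CriticalPhenomena-CardyBlackNoise"]
def BlackNoCameronMartin : Prop :=
  ∀ (Ω : Type) (m : MeasurableSpace Ω) (P Q : MeasureTheory.Measure Ω) (N : ℕ → ℕ) (F : (n : ℕ) → Fin (N n) → MeasurableSpace Ω), MeasureTheory.IsProbabilityMeasure P → MeasureTheory.IsProbabilityMeasure Q → (∀ n i, F n i ≤ m) → (∀ n (s : Set Ω), MeasurableSet s → ∃ t : Set Ω, MeasurableSet[⨆ i, F n i] t ∧ Filter.EventuallyEq (MeasureTheory.ae P) s t) → (∀ n, ProbabilityTheory.iIndep (F n) P) → (∀ n, ProbabilityTheory.iIndep (F n) Q) → (∀ X : Ω → ℝ, MeasureTheory.MemLp X 2 P → Filter.Tendsto (fun n => ∑ i : Fin (N n), ProbabilityTheory.variance (MeasureTheory.condExp (F n i) P X) P) Filter.atTop (nhds 0)) → MeasureTheory.Measure.AbsolutelyContinuous Q P → Q = P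

/-- item stmt-CriticalPhenomena-8852 · support · rank 9 · open · by planner
sources: doi:10.1007/978-1-4612-4350-2, arXiv:2012.11672, arXiv:1101.5820
[support] (card K3, Lie-algebra level) let L be a set of functions holomorphic on the unit disc
(membership decided on the disc), an ℝ-linear subspace closed under the bracket [f,g] = f g′ − f′ g,
under rotations f ↦ (w ↦ e^(iθ) f(e^(−iθ) w)) and under locally uniform limits on the disc,
containing 1, i and i·z (the Euclidean algebra e(2)); then EITHER every element of L is a polynomial
of degree ≤ 2 on the disc (L ⊆ Möbius algebra) OR L contains every function holomorphic on the disc.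
Proof sketch: Fourier-isolate a mode a_k z^k with k ≥ 3 by averaging rotations against
cos/sin((k−1)θ) (Riemann sums + closure), get ℂ z^k ⊆ L; [1, z^k] = k z^(k−1) descends, [z², z^k] =
(k−2) z^(k+1) ascends; Taylor partial sums are locally uniformly dense. [difficulty: provable-now] -/
@[route_item "route-CriticalPhenomena-CardyBlackNoise"]
def ConformalGeneration : Prop :=
  ∀ L : Set (ℂ → ℂ), (∀ f ∈ L, DifferentiableOn ℂ f (Metric.ball (0 : ℂ) 1)) → (∀ f ∈ L, ∀ g : ℂ → ℂ, Set.EqOn f g (Metric.ball (0 : ℂ) 1) → g ∈ L) → (0 : ℂ → ℂ) ∈ L → (∀ f ∈ L, ∀ g ∈ L, f + g ∈ L) → (∀ r : ℝ, ∀ f ∈ L, (r : ℂ) • f ∈ L) → (∀ f ∈ L, ∀ g ∈ L, (fun z => f z * deriv g z - deriv f z * g z) ∈ L) → (fun _ => (1 : ℂ)) ∈ L → (fun _ => Complex.I) ∈ L → (fun z => Complex.I * z) ∈ L → (∀ θ : ℝ, ∀ f ∈ L, (fun w => Complex.exp (θ * Complex.I) * f (Complex.exp (-(θ * Complex.I))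 * w)) ∈ L) → (∀ (u : ℕ → ℂ → ℂ) (g : ℂ → ℂ), (∀ n, u n ∈ L) → TendstoLocallyUniformlyOn u g Filter.atTop (Metric.ball (0 : ℂ) 1) → g ∈ L) → ((∀ f ∈ L, ∃ p : Polynomial ℂ, p.natDegree ≤ 2 ∧ Set.EqOn f (fun z => p.eval z) (Metric.ball (0 : ℂ) 1)) ∨ (∀ g : ℂ → ℂ, DifferentiableOn ℂ g (Metric.ball (0 : ℂ) 1) → g ∈ L))

/-- item stmt-CriticalPhenomena-8853 · assembly · rank 1 · open · by planner
sources: SchrammSmirnov2011, Smirnov2001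
[assembly] NonSingularOverlay → BlackDichotomy → OverlayUpgrade → SubseqCardyRigidity →
ConformalGeneration → CardyFormulaZ2. -/
@[route_item "route-CriticalPhenomena-CardyBlackNoise"]
def Assembly : Prop :=
  NonSingularOverlay → BlackDichotomy → OverlayUpgrade → SubseqCardyRigidity → ConformalGeneration → CardyFormulaZ2

/-! D-0027 §2.1 — DECIDING THEOREM (planner-authored via `route open/edit --closes-file`; by planner-rbadge-CriticalPhenomena-CardyBlackNoi-f7f69ed8-g2-0 2026-08-15T16:18:27Z):
its hypotheses are this route's items and its conclusion the sub-problem Statement (glue_lint), and it elaborates with this file. -/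

@[closes "route-CriticalPhenomena-CardyBlackNoise"] theorem closes (h₂ : NonSingularOverlay) (h₃ : BlackDichotomy) (h₄ : OverlayUpgrade)
    (h₅ : SubseqCardyRigidity) : _root_.CardyFormulaZ2 := by
  -- D-0027 §2.1 deciding theorem of route CardyBlackNoise (conclusion = the sub-problem Statement
  -- `_root_.CardyFormulaZ2` BY NAME; hypotheses = the route's ranked cruxes #2–#5).
  -- Layer 2 → layer 1: the measure-class chain OverlayUpgrade, fed the overlay crux and the
  -- black-noise dichotomy, yields the target X = SubseqConformalInvariance (item #0).
  have hX : SubseqConformalInvariance := h₄ h₂ h₃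
  -- Layer 1 → Statement (pure logic + `𝓝[>] 0` countably generated): fix R and a uniformizing
  -- datum (φ, x); it suffices that every mesh sequence u → 0⁺ has a subsequence u ∘ ψ along which
  -- bondDomainCrossingProb R → F(crossRatio x). X supplies ψ and a conformally invariant
  -- subsequential limit f; SubseqCardyRigidity along u ∘ ψ pins f = F on (0,1); and
  -- crossRatio x ∈ (0,1) for a uniformizing datum. LimitExists is output, never assumed.
  intro R φ x hφ
  refine Filter.tendsto_of_subseq_tendsto fun u hu => ?_
  obtain ⟨ψ, f, hψ, hf⟩ := hX u hu
  have huψ : Filter.Tendsto (u ∘ ψ) Filter.atTop (nhdsWithin 0 (Set.Ioi 0)) :=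
    hu.comp hψ.tendsto_atTop
  have hfF : Set.EqOn f Literature.Probability.RandomPlanarGeometry.cardyFunction (Set.Ioo 0 1) :=
    h₅ (u ∘ ψ) f huψ fun R' φ' x' hφ' => hf R' φ' x' hφ'
  have hη : Literature.Probability.RandomPlanarGeometry.crossRatio x ∈ Set.Ioo (0 : ℝ) 1 :=
    Literature.Probability.RandomPlanarGeometry.ConformalRectangle.crossRatio_mem_Ioo_of_isUniformizing hφ
  refine ⟨ψ, ?_⟩
  have hlim := hf R φ x hφ
  rw [hfF hη] at hlim
  exact hlim

end Summit.CriticalPhenomena.CardyFormulaZ2.Theses.CardyBlackNoise
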